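import Summits.BirchSwinnertonDyer.Rank1Residual.Additive.RamifiedOrdinaryLineUniqueClasses
import Summits.BirchSwinnertonDyer.Rank1Residual.AdditivePotMult.PotMultRamifiedLineKummerEqAt
import Summits.BirchSwinnertonDyer.Rank1Residual.X2.GreenbergVatsalTateDatumCofree
import Literature.NumberTheory.EllipticCurves.CyclotomicLineWeilPairingProofs
import HarnessLib

/-!
# UNIQUENESS of the ramified ordinary line — MODEL-FREE: any two ramified ordinary lines of the
# same curve at the same `v ∣ p` coincide (every prime `p`, every semistability defect, no twist
# model, no class hypothesis)

HONEST FRAMING (BSD rank-`≤ 1` residual cell `b2b-bsdres`, home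
`run/shared/lean/b2b/bsd-rank1-residual/`, lane CLASS-CLOSURE, seat cc-typer-2 = typer of record
N10 §3.2 / O7 §3.3, team n1011; n1011 R5-47 (b): cc-typer-2 = owner of `IsRamifiedOrdinaryLine`
uniqueness; typer-lane sequel S1 of n1011-p05's row T-ROL-G, INBOX 2026-08-21 l.4653 / l.4689):
the cell deletes COMBINATION-SHAPED residual classes of the rank-`≤ 1` BSD formula from PUBLISHED
theorems only and TYPES the construction-shaped ones; research route, no claim beyond stated classes;
census output = EVIDENCE; nothing is booked by this file; no RESIDUAL-MAP mark moves. Theorems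
only: NO definition, NO named fact, NO conjecture node.

WHAT. The sibling files prove uniqueness of the ramified ordinary line
(`IsRamifiedOrdinaryLine W p L`, EPW 2006 §3.1 read on the curve) only for curves whose `p`-primary
torsion is a signed transport of a good-ordinary `V[p^∞]` — i.e. on the defect-`2` rows
(`ClassX4Gord/ClassX3Gord.eq_of_isRamifiedOrdinaryLine (he : semistabilityIndex W p = 2)`,
`RamifiedOrdinaryLineUniqueClasses`) and on the potentially multiplicative rows (Tate datum,
`RamifiedOrdinaryLineUniquePotMult`) — because the inertia SCALAR required by the datum-level
theorem `LocalDatum.plus_eq_of_inertia_scalar` (an inertia element acting on the line as a natural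
number `u > 1`) was produced from the reduction line of a MODEL. This file produces that scalar
WITHOUT any model, for EVERY ramified ordinary line, from the Weil pairing on `E` itself
(`det ρ_{E,p^k} = χ_p`, the tree's `WeierstrassCurve.localPoints_exists_isPrimitiveRoot_smul_eq_pow`):
if `σ₀ ∈ I_v` has `χ_p(σ₀) = 1 + p` (local Kronecker–Weber,
`adicCompletion_rat_exists_mem_absInertia_cyclotomicCharacter_eq`) and `n ≥ 1` kills the inertia
action on `E[p^∞]/C` (clause 4 of `IsRamifiedOrdinaryLine`), then `σ = σ₀ⁿ` acts trivially on
`E[p^∞]/C`, hence — in a basis `(P_k, Q)` of `E[p^k]` with `P_k ∈ C` — as `(c *; 0 1)`, so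
`c ≡ det = χ_p(σ) = (1+p)ⁿ (mod p^k)` for every `k`: `σ` acts on `C` as the natural scalar
`u = (1+p)ⁿ > 1` (§2). Consequently (§3) ANY two ramified ordinary lines of the same `E/ℚ` at the
same `v ∋ p` coincide — every `p`, every semistability defect (`e ∈ {2, 3, 4, 6}` and potentially
multiplicative alike), no class hypothesis: GV's "`C` is determined by the action of `I_p`" (p. 26) /
Coates' "canonical subgroup" (LNM 1716 (62)) as a theorem about the predicate. §1 = the generic input
(a `p`-divisible `S` in a `p`-primary group with `#(S ∩ D[p]) = p` has a generator of order `p^k` of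
its `p^k`-torsion, every `k`). §4 = the cell's adapters WITHOUT the `he : semistabilityIndex W p = 2`
binder (`Additive.ramifiedLineKummerEqAt_of_exists` for ANY `W`; primed class forms covering the
`Gord_e346` rows of n1011-p05's T-ROL-G line by name).

References: Greenberg–Vatsal, Invent. Math. 142 (2000) §2 p. 26 [GreenbergVatsal2000]; Coates,
LNM 1716 (1999) p. 31 (62) [CoatesLNM1716]; Greenberg, LNM 1716 §2 pp. 63, 70 [GreenbergLNM1716];
Emerton–Pollack–Weston (2006) §3.1 [EmertonPollackWeston2006]; Silverman *AEC* III.8.1, III.6.4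
[SilvermanAEC2009]; Serre, *Local Fields* IV §4 Prop. 17 [SerreLocalFields1979].
-/

noncomputable section

open scoped Classical AddSubgroup NNReal

open NumberField IsDedekindDomain Field
  Literature.NumberTheory.GaloisRepresentations
  Literature.NumberTheory.EllipticCurves
  Literature.NumberTheory.EllipticCurves.GreenbergSelmer
  Literature.NumberTheory.EllipticCurves.EmertonPollackWeston2006
  IsDedekindDomain.HeightOneSpectrum
  Summit.BirchSwinnertonDyer.Rank1Residual.X2
  Summit.BirchSwinnertonDyer.Rank1Residual.X2.GreenbergVatsalReductionDatum
  Summit.BirchSwinnertonDyer.Rank1Residual.X2.GreenbergVatsalTateDatumCofree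
  Summit.BirchSwinnertonDyer.Rank1Residual.X2.TrivialZeroCorankAlgebra
  Summit.BirchSwinnertonDyer.Rank1Residual.Additive.RamifiedOrdinaryLineUnique
  Summit.BirchSwinnertonDyer.Rank1Residual.AdditivePotMult.RamifiedLineUnique
open WeierstrassCurve (minimalDiscriminantInt integralModelInt)

universe u

/-! ## §1. Generic: generators of the `p^k`-torsion of a divisible line -/

namespace Summit.BirchSwinnertonDyer.Rank1Residual.Additive.RamifiedOrdinaryLineUniqueModelFree

section Generic

variable (p : ℕ) [hp : Fact p.Prime] {D : Type*} [AddCommGroup D] (S : AddSubgroup D)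

/-- In a subgroup `S` with `#(S ∩ D[p]) = p`: every element of `S` killed by `p` is a natural multiple
of any given non-zero element of `S` killed by `p` (a group of prime order is generated by each of
its non-zero elements). [folklore] -/
theorem exists_nsmul_eq_of_pTorsion_of_natCard
    (hcard : Nat.card ↥(S ⊓ D[(p : ℤ)]) = p) {t₀ : D} (ht₀S : t₀ ∈ S) (ht₀p : p • t₀ = 0)
    (ht₀ : t₀ ≠ 0) {t : D} (htS : t ∈ S) (htp : p • t = 0) : ∃ j : ℕ, t = j • t₀ := by
  set K : AddSubgroup D := S ⊓ D[(p : ℤ)] with hK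
  haveI : Fact (Nat.card ↥K).Prime := ⟨by rw [hcard]; exact hp.out⟩
  haveI : Finite ↥K := Nat.finite_of_card_ne_zero (by rw [hcard]; exact hp.out.ne_zero)
  have hmem : ∀ {x : D}, x ∈ S → p • x = 0 → x ∈ K := fun hx hxp ↦
    AddSubgroup.mem_inf.2 ⟨hx, AddSubgroup.torsionBy.nsmul_iff.mpr hxp⟩
  set x₀ : ↥K := ⟨t₀, hmem ht₀S ht₀p⟩ with hx₀
  set x : ↥K := ⟨t, hmem htS htp⟩ with hx
  have hx₀ne : x₀ ≠ 0 := fun h ↦ ht₀ (congrArg Subtype.val h)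
  -- `ℤ x₀ = K`
  have htop : AddSubgroup.zmultiples x₀ = ⊤ := by
    rcases (AddSubgroup.zmultiples x₀).eq_bot_or_eq_top_of_prime_card with h | h
    · exact absurd ((AddSubgroup.zmultiples_eq_bot).mp h) hx₀ne
    · exact h
  have hxmem : x ∈ AddSubgroup.zmultiples x₀ := by rw [htop]; exact AddSubgroup.mem_top _
  rw [← mem_multiples_iff_mem_zmultiples, AddSubmonoid.mem_multiples_iff] at hxmem
  obtain ⟨j, hj⟩ := hxmem
  exact ⟨j, by have := congrArg Subtype.val hj; simpa [hx, hx₀] using this.symm⟩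

/-- **Generation from order.** In a subgroup `S` with `#(S ∩ D[p]) = p`, an element `P ∈ S` of
order `p^k` generates the `p^k`-torsion of `S`: every `Q ∈ S` with `p^k Q = 0` is a natural
multiple of `P`. (Induction on `k`: `p^{k} Q` and `p^{k} P` are `p`-torsion, the latter non-zero, so
`p^k Q = j p^k P`; then `Q − jP` is `p^k`-torsion and `pP` has order `p^k`.) [folklore] -/
theorem exists_nsmul_eq_of_addOrderOf_eq (hcard : Nat.card ↥(S ⊓ D[(p : ℤ)]) = p) :
    ∀ (k : ℕ) {P : D}, P ∈ S → addOrderOf P = p ^ k →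
      ∀ {Q : D}, Q ∈ S → p ^ k • Q = 0 → ∃ j : ℕ, Q = j • P := by
  intro k
  induction k with
  | zero =>
    intro P _ _ Q _ hQ
    rw [pow_zero, one_nsmul] at hQ
    exact ⟨0, by rw [hQ, zero_nsmul]⟩
  | succ k ih =>
    intro P hPS hPord Q hQS hQ
    -- `p^k P` is a non-zero `p`-torsion element of `S`
    have hPk0 : p ^ k • P ≠ 0 := nsmul_ne_zero_of_lt_addOrderOf (pow_ne_zero k hp.out.ne_zero)
      (by rw [hPord]; exact Nat.pow_lt_pow_right hp.out.one_lt (Nat.lt_succ_self k))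
    have hPkp : p • (p ^ k • P) = 0 := by
      rw [← mul_nsmul', ← pow_succ', ← hPord]; exact addOrderOf_nsmul_eq_zero P
    have hQkp : p • (p ^ k • Q) = 0 := by rw [← mul_nsmul', ← pow_succ']; exact hQ
    obtain ⟨j, hj⟩ := exists_nsmul_eq_of_pTorsion_of_natCard p S hcard (S.nsmul_mem hPS _) hPkp
      hPk0 (S.nsmul_mem hQS _) hQkp
    -- `Q - jP` is `p^k`-torsion; `pP` has order `p^k`
    have hR : p ^ k • (Q - j • P) = 0 := by
      rw [nsmul_sub, hj, ← mul_nsmul', ← mul_nsmul', mul_comm, sub_self]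
    have hpPord : addOrderOf (p • P) = p ^ k := by
      rw [addOrderOf_nsmul_of_dvd hp.out.ne_zero (by rw [hPord]; exact dvd_pow_self p k.succ_ne_zero),
        hPord, pow_succ, Nat.mul_div_cancel _ hp.out.pos]
    obtain ⟨j', hj'⟩ := ih (S.nsmul_mem hPS p) hpPord (S.sub_mem hQS (S.nsmul_mem hPS j)) hR
    refine ⟨j' * p + j, ?_⟩
    rw [add_nsmul, mul_nsmul', ← hj', sub_add_cancel]

/-- **A divisible line has generators of every order.** In a `p`-primary group `D`, a `p`-divisible
subgroup `S` with `#(S ∩ D[p]) = p` contains, for every `k`, an element `P` of order exactly `p^k`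
such that every `Q ∈ S` with `p^k Q = 0` is a natural multiple of `P` (`S ≅ ℚ_p/ℤ_p`; `P` = a
`(k−1)`-fold `p`-th root of a non-zero `p`-torsion element). [folklore] -/
theorem exists_generator_of_pDivisible_of_natCard (hD : ∀ d : D, ∃ k : ℕ, p ^ k • d = 0)
    (hdiv : ∀ s ∈ S, ∃ s' ∈ S, p • s' = s) (hcard : Nat.card ↥(S ⊓ D[(p : ℤ)]) = p) (k : ℕ) :
    ∃ P ∈ S, addOrderOf P = p ^ k ∧ ∀ Q ∈ S, p ^ k • Q = 0 → ∃ j : ℕ, Q = j • P := by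
  suffices h : ∃ P ∈ S, addOrderOf P = p ^ k by
    obtain ⟨P, hPS, hPord⟩ := h
    exact ⟨P, hPS, hPord, fun Q hQS hQ ↦ exists_nsmul_eq_of_addOrderOf_eq p S hcard k hPS hPord hQS hQ⟩
  rcases k with _ | k
  · exact ⟨0, S.zero_mem, by rw [pow_zero, addOrderOf_zero]⟩
  -- a non-zero `p`-torsion element `t₀ ∈ S`
  set K : AddSubgroup D := S ⊓ D[(p : ℤ)] with hK
  haveI : Finite ↥K := Nat.finite_of_card_ne_zero (by rw [hcard]; exact hp.out.ne_zero)
  have hKne : K ≠ ⊥ := (AddSubgroup.one_lt_card_iff_ne_bot K).mp (by rw [hcard]; exact hp.out.one_lt)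
  obtain ⟨x₀, hx₀⟩ := (AddSubgroup.ne_bot_iff_exists_ne_zero).mp hKne
  have ht₀S : (x₀ : D) ∈ S := (AddSubgroup.mem_inf.1 x₀.2).1
  have ht₀p : p • (x₀ : D) = 0 := AddSubgroup.torsionBy.nsmul_iff.mp (AddSubgroup.mem_inf.1 x₀.2).2
  have ht₀ : (x₀ : D) ≠ 0 := fun h ↦ hx₀ (Subtype.ext h)
  -- divide `k` times by `p` inside `S`
  obtain ⟨P, hPS, hP⟩ := forall_exists_nsmul_eq_of_pDivisible p hD S hdiv
    (pow_ne_zero k hp.out.ne_zero) (x₀ : D) ht₀S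
  refine ⟨P, hPS, addOrderOf_eq_prime_pow (by rw [hP]; exact ht₀) ?_⟩
  rw [pow_succ', mul_nsmul', hP]
  exact ht₀p

end Generic

/-! ## §2. The inertia scalar on a ramified ordinary line, from the Weil pairing alone -/

section Scalar

variable {W : WeierstrassCurve ℚ} [W.IsElliptic] {p : ℕ} [hp : Fact p.Prime]
  {v : HeightOneSpectrum (𝓞 ℚ)}

/-- `1 + p`, and its powers, are `p`-adic units. [folklore] -/
theorem isUnit_natCast_one_add_pow (n : ℕ) : IsUnit ((((1 + p) ^ n : ℕ)) : ℤ_[p]) := by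
  rw [PadicInt.isUnit_iff]
  refine le_antisymm (PadicInt.norm_le_one _) (not_lt.mp fun hlt ↦ ?_)
  have hlt' : ‖((((1 + p) ^ n : ℕ) : ℤ) : ℤ_[p])‖ < 1 := by exact_mod_cast hlt
  have hdvd : (p : ℤ) ∣ (((1 + p) ^ n : ℕ) : ℤ) := (PadicInt.norm_int_lt_one_iff_dvd _).mp hlt'
  have hdvd' : p ∣ (1 + p) ^ n := by exact_mod_cast hdvd
  have h1 : p ∣ 1 + p := hp.out.dvd_of_dvd_pow hdvd'
  exact hp.out.ne_one (Nat.dvd_one.mp ((Nat.dvd_add_right (dvd_refl p)).mp (by rwa [add_comm] at h1)))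

end Scalar

end Summit.BirchSwinnertonDyer.Rank1Residual.Additive.RamifiedOrdinaryLineUniqueModelFree

namespace Literature.NumberTheory.EllipticCurves.EmertonPollackWeston2006.IsRamifiedOrdinaryLine

open Summit.BirchSwinnertonDyer.Rank1Residual.Additive.RamifiedOrdinaryLineUniqueModelFree

variable {W : WeierstrassCurve ℚ} [W.IsElliptic] {p : ℕ} [hp : Fact p.Prime]
  {v : HeightOneSpectrum (𝓞 ℚ)}

/-- **An inertia element acts on a ramified ordinary line as a natural scalar `u > 1` — for EVERY
ramified ordinary line, with no model.** `E/ℚ` elliptic, `p` prime, `v ∋ p`, `L` a ramified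
ordinary line at `v` (`C = L.plus` divisible, `≠ 0`, `≠ E[p^∞]`, inertia acting on `E[p^∞]/C`
through a quotient killed by some `n ≥ 1`). Take `σ₀ ∈ I_v` with `χ_p(σ₀) = 1 + p` (local
Kronecker–Weber) and `σ = σ₀ⁿ`: `σ` acts trivially on `E[p^∞]/C`, so on a basis `(P_k, Q)` of
`E[p^k]` with `P_k ∈ C` it is `(c *; 0 1)` and `c ≡ det ρ(σ) = χ_p(σ) = (1+p)ⁿ (mod p^k)` by the
Weil pairing (`e_{p^k}(σQ, σP_k) = e^{c}`; Silverman III.8.1) — for every `k`. Hence `σ m = u m` for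
all `m ∈ C`, `u = (1+p)ⁿ > 1`. This is GV's "`C` is determined by the action of `I_p`" (p. 26) made
effective; hypothesis (c) of `LocalDatum.plus_eq_of_inertia_scalar`.
[cite: GreenbergVatsal2000, §2 p. 26] [cite: SilvermanAEC2009, Prop. III.8.1]
[cite: SerreLocalFields1979, Ch. IV §4 Prop. 17] -/
theorem exists_inertia_natScalar {L : LocalDatum ℚ ↥(W.geomPrimaryTorsion p) v}
    (hL : IsRamifiedOrdinaryLine W p L) (hpv : ((p : ℕ) : 𝓞 ℚ) ∈ v.asIdeal) :
    ∃ σ ∈ absInertia (v.adicCompletion ℚ), ∃ u : ℕ, 1 < u ∧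
      ∀ m ∈ L.plus, absGaloisRestrict ℚ (v.adicCompletion ℚ) σ • m = u • m := by
  obtain ⟨hdiv, -, -, ⟨n, hn, hN⟩, -⟩ := id hL
  have hCp := natCard_plus_inf_torsionBy_eq hL
  have hprim :=
    Summit.BirchSwinnertonDyer.Rank1Residual.Additive.RamifiedOrdinaryLineUnique.exists_pow_nsmul_eq_zero W p
  -- no `CharZero ℚ_v` instance juggling: `p ≠ 0` in `ℚ_v`
  haveI : NeZero ((p : ℕ) : v.adicCompletion ℚ) := ⟨by
    rw [← map_natCast (algebraMap ℚ (v.adicCompletion ℚ))]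
    exact (map_ne_zero_iff _ (algebraMap ℚ (v.adicCompletion ℚ)).injective).mpr
      (Nat.cast_ne_zero.mpr hp.out.ne_zero)⟩
  -- `σ₀` with `χ_p(σ₀) = 1 + p`, `σ = σ₀ ^ n`, `u = (1 + p) ^ n`
  have hu1 : IsUnit ((((1 + p) ^ 1 : ℕ)) : ℤ_[p]) := isUnit_natCast_one_add_pow (p := p) 1
  have hvp : (Rat.HeightOneSpectrum.primesEquiv v : ℕ) = p :=
    Rat.HeightOneSpectrum.primesEquiv_eq_of_natCast_mem v hp.out hpv
  obtain ⟨σ₀, hσ₀I, hχ₀⟩ :=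
    adicCompletion_rat_exists_mem_absInertia_cyclotomicCharacter_eq p v hvp hu1.unit
  set σ : absoluteGaloisGroup (v.adicCompletion ℚ) := σ₀ ^ n with hσdef
  have hσI : σ ∈ absInertia (v.adicCompletion ℚ) := Subgroup.pow_mem _ hσ₀I n
  set u : ℕ := (1 + p) ^ n with hudef
  have hu : 1 < u := Nat.one_lt_pow hn.ne' (by have := hp.out.one_lt; omega)
  -- `χ_p(σ) mod p^k = u mod p^k`
  have hχσ : ∀ k : ℕ,
      ((GaloisRep.cyclotomicCharacter (v.adicCompletion ℚ) p σ).val.toZModPow k).val = u % p ^ k := by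
    intro k
    rw [hσdef, map_pow, Units.val_pow_eq_pow_val, hχ₀, IsUnit.unit_spec, pow_one, ← Nat.cast_pow,
      map_natCast, ZMod.val_natCast]
  -- `σ` acts trivially on `E[p^∞]/C`
  have hσtriv : ∀ m : ↥(W.geomPrimaryTorsion p),
      absGaloisRestrict ℚ (v.adicCompletion ℚ) σ • m - m ∈ L.plus := by
    intro m
    have h := hN σ₀ hσ₀I m
    rwa [← map_pow] at h
  refine ⟨σ, hσI, u, hu, fun m hm ↦ ?_⟩
  -- Galois elements commute with natural multiples
  have hcomm : ∀ (g : absoluteGaloisGroup ℚ) (c : ℕ) (x : ↥(W.geomPrimaryTorsion p)),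
      g • (c • x) = c • (g • x) := fun g c x ↦
    map_nsmul (DistribSMul.toAddMonoidHom ↥(W.geomPrimaryTorsion p) g) c x
  -- the level `k` of `m` and a generator `P` of `C[p^k]`
  obtain ⟨k, hk⟩ := hprim m
  obtain ⟨P, hPC, hPord, hPgen⟩ :=
    exists_generator_of_pDivisible_of_natCard p L.plus hprim hdiv hCp k
  -- `σ P = c • P` for some `c`
  obtain ⟨c', hc'⟩ := hPgen _ (hσtriv P) (by
    rw [nsmul_sub, ← hcomm, ← hPord, addOrderOf_nsmul_eq_zero, smul_zero, sub_self])
  set c : ℕ := c' + 1 with hcdef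
  have hσP : absGaloisRestrict ℚ (v.adicCompletion ℚ) σ • P = c • P := by
    rw [hcdef, add_nsmul, one_nsmul, ← hc', sub_add_cancel]
  -- transport to `E(K̄_v)`
  set ι : ↥(W.geomPrimaryTorsion p) →+ localPoints W (v.adicCompletion ℚ) :=
    (pointsMap W (v.adicCompletion ℚ)).comp (W.geomPrimaryTorsion p).subtype with hιdef
  have hι : ∀ x : ↥(W.geomPrimaryTorsion p), ι x = pointsMap W (v.adicCompletion ℚ) (x : W.geomPoints) :=
    fun _ ↦ rfl
  have hιinj : Function.Injective ι := fun x y h ↦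
    pointsMap_coe_injective W p (v := v) (by simpa only [hι] using h)
  have hισ : ∀ x : ↥(W.geomPrimaryTorsion p),
      ι (absGaloisRestrict ℚ (v.adicCompletion ℚ) σ • x) = σ • ι x := by
    intro x
    rw [hι, hι, primaryComponent.coe_smul, pointsMap_absGaloisRestrict_smul]
  set P₀ : localPoints W (v.adicCompletion ℚ) := ι P with hP₀
  have hP₀ord : addOrderOf P₀ = p ^ k := by rw [hP₀, addOrderOf_injective ι hιinj, hPord]
  -- (h1) `σ P₀ = c P₀`
  have h1 : ∀ τ ∈ ({σ} : Set (absoluteGaloisGroup (v.adicCompletion ℚ))), τ • P₀ = c • P₀ := by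
    intro τ hτ
    rw [Set.mem_singleton_iff.mp hτ, hP₀, ← hισ, hσP, map_nsmul]
  -- (h2) `σ` moves every `p^k`-torsion point of `E(K̄_v)` by a multiple of `P₀`
  have h2 : ∀ τ ∈ ({σ} : Set (absoluteGaloisGroup (v.adicCompletion ℚ))),
      ∀ Q : localPoints W (v.adicCompletion ℚ), ((p ^ k : ℕ) : ℤ) • Q = 0 →
        ∃ d : ℕ, τ • Q - (fun _ ↦ (1 : ℕ)) τ • Q = d • P₀ := by
    intro τ hτ Q hQ
    rw [Set.mem_singleton_iff.mp hτ]
    rw [natCast_zsmul] at hQ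
    obtain ⟨m', hm'⟩ := exists_primaryTorsion_pointsMap_eq W p Q k hQ
    have hm'k : p ^ k • m' = 0 := hιinj (by rw [map_nsmul, hι, hm', hQ, map_zero])
    obtain ⟨d, hd⟩ := hPgen _ (hσtriv m') (by
      rw [nsmul_sub, ← hcomm, hm'k, smul_zero, sub_self])
    refine ⟨d, ?_⟩
    rw [one_nsmul, ← hm', ← hι m', ← hισ, ← map_sub, hd, map_nsmul]
  obtain ⟨ζ, hζ, hζσ⟩ := @WeierstrassCurve.localPoints_exists_isPrimitiveRoot_smul_eq_pow ℚ _ W _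
    (v.adicCompletion ℚ) _ _
    (charZero_of_injective_algebraMap (algebraMap ℚ (v.adicCompletion ℚ)).injective) p _ k P₀
    hP₀ord ({σ} : Set (absoluteGaloisGroup (v.adicCompletion ℚ))) (fun _ ↦ c) (fun _ ↦ 1) h1 h2
  -- compare exponents on `ζ`: `c ≡ χ_p(σ) ≡ u (mod p^k)`
  have hσζ : σ • ζ = ζ ^ (u % p ^ k) := by
    rw [← hχσ k]
    exact GaloisRep.cyclotomicCharacter_spec (v.adicCompletion ℚ) p σ ζ hζ.pow_eq_one
  have hcmp : ζ ^ (c % p ^ k) = ζ ^ (u % p ^ k) := by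
    rw [← hσζ, hζσ σ (Set.mem_singleton σ), one_mul, hζ.eq_orderOf, pow_mod_orderOf]
  have hmod : c % p ^ k = u % p ^ k :=
    hζ.pow_inj (Nat.mod_lt _ (pow_pos hp.out.pos k)) (Nat.mod_lt _ (pow_pos hp.out.pos k)) hcmp
  have hσPu : absGaloisRestrict ℚ (v.adicCompletion ℚ) σ • P = u • P := by
    rw [hσP, ← mod_addOrderOf_nsmul, hPord, hmod, ← hPord, mod_addOrderOf_nsmul]
  -- `m = j • P`
  obtain ⟨j, rfl⟩ := hPgen m hm hk
  rw [hcomm, hσPu, ← mul_nsmul', ← mul_nsmul', mul_comm]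

/-- **UNIQUENESS OF THE RAMIFIED ORDINARY LINE (model-free): the lines coincide.** For an elliptic
`E/ℚ`, a prime `p`, the place `v ∋ p`, and any two ramified ordinary lines `L₁`, `L₂` of `E[p^∞]`
at `v`: `L₁.plus = L₂.plus`. (The datum-level theorem `LocalDatum.plus_eq_of_inertia_scalar` fed
with §0 folklore `#(C ∩ E[p^∞][p]) = p` and the model-free scalar `exists_inertia_natScalar`.) Every
`p`, every semistability defect, no twist model, no class hypothesis. GV p. 26 "`C` is determined by
the action of `I_p`"; Coates LNM 1716 (62) "the canonical subgroup".
[cite: GreenbergVatsal2000, §2 p. 26] [cite: CoatesLNM1716, p. 31 (62)] [cite: GreenbergLNM1716, §2 p. 63] -/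
theorem plus_eq_plus {L₁ L₂ : LocalDatum ℚ ↥(W.geomPrimaryTorsion p) v}
    (hL₁ : IsRamifiedOrdinaryLine W p L₁) (hL₂ : IsRamifiedOrdinaryLine W p L₂)
    (hpv : ((p : ℕ) : 𝓞 ℚ) ∈ v.asIdeal) : L₁.plus = L₂.plus :=
  L₂.plus_eq_plus_of_isRamifiedOrdinaryLine_of_inertia_scalar (fun _ hc ↦ hL₂.divisible hc)
    (natCard_plus_inf_torsionBy_eq hL₂) (hL₂.exists_inertia_natScalar hpv) hL₁

/-- **UNIQUENESS OF THE RAMIFIED ORDINARY LINE (model-free): the data coincide** (`L₁ = L₂`, by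
`LocalDatum.eq_of_plus_eq`). Every `p`, every semistability defect, no model, no class.
[cite: GreenbergVatsal2000, §2 p. 26] [cite: CoatesLNM1716, p. 31 (62)] -/
theorem eq_of_isRamifiedOrdinaryLine {L₁ L₂ : LocalDatum ℚ ↥(W.geomPrimaryTorsion p) v}
    (hL₁ : IsRamifiedOrdinaryLine W p L₁) (hL₂ : IsRamifiedOrdinaryLine W p L₂)
    (hpv : ((p : ℕ) : 𝓞 ℚ) ∈ v.asIdeal) : L₁ = L₂ :=
  LocalDatum.eq_of_plus_eq (hL₁.plus_eq_plus hL₂ hpv)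

/-- **At most one ramified ordinary line per `(E, p, v)`** (`Subsingleton` form of the uniqueness).
[cite: GreenbergVatsal2000, §2 p. 26] -/
theorem subsingleton (hpv : ((p : ℕ) : 𝓞 ℚ) ∈ v.asIdeal) :
    Subsingleton {L : LocalDatum ℚ ↥(W.geomPrimaryTorsion p) v // IsRamifiedOrdinaryLine W p L} :=
  ⟨fun L₁ L₂ ↦ Subtype.ext (L₁.2.eq_of_isRamifiedOrdinaryLine L₂.2 hpv)⟩

end Literature.NumberTheory.EllipticCurves.EmertonPollackWeston2006.IsRamifiedOrdinaryLine

/-! ## §4. The cell's adapters without the `he` binder -/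

namespace Summit.BirchSwinnertonDyer.Rank1Residual.Additive

variable (W : WeierstrassCurve ℚ) [W.IsElliptic] (p : ℕ) [hp : Fact p.Prime]

/-- **The δ-input `RamifiedLineKummerEqAt W p` from ONE identified line per `(κ, v)` — for ANY
elliptic `E/ℚ` and ANY prime `p`** (no class, no `semistabilityIndex` binder): if for every
cyclotomic `κ` and every `v ∋ p` SOME ramified ordinary line `L` has
`L.greenbergKer κ.ker = W.localKerOver p κ.ker ℚ_v`, then EVERY ramified ordinary line does
(there is only one, `IsRamifiedOrdinaryLine.plus_eq_plus`). Supersedes the `he = 2` forms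
`ClassX4Gord/ClassX3Gord.ramifiedLineKummerEqAt_of_exists` and the Tate form
`PotMult.ramifiedLineKummerEqAt_of_exists` as far as uniqueness is concerned (their R-D content is
untouched). Nothing booked. [cite: GreenbergVatsal2000, §2 p. 16 and p. 26] -/
theorem ramifiedLineKummerEqAt_of_exists
    (h : ∀ (κ : ZpExtension ℚ p), κ.IsCyclotomic →
      ∀ (v : HeightOneSpectrum (𝓞 ℚ)) (hv : ((p : ℕ) : 𝓞 ℚ) ∈ v.asIdeal),
        ∃ L : LocalDatum ℚ (W.geomPrimaryTorsion p) v, IsRamifiedOrdinaryLine W p L ∧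
          L.greenbergKer κ.kerSubgroup = W.localKerOver p κ.kerSubgroup (v.adicCompletion ℚ)) :
    RamifiedLineKummerEqAt W p :=
  ramifiedLineKummerEqAt_of_exists_of_plus_unique W p (fun _ hv _ _ hL hL' ↦ hL.plus_eq_plus hL' hv) h

variable {W p}

/-- **X4♯(G-ord), EVERY semistability defect `e ∈ {2, 3, 4, 6}`, every `p`: the ramified ordinary
line is UNIQUE** — `ClassX4Gord.eq_of_isRamifiedOrdinaryLine` WITHOUT its `he : e = 2` binder (the
class hypothesis itself is not used either; kept for by-name consumers of the T-ROL-G line on the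
`Gord_e346` rows). X4♯(G-ord) stays as labelled; nothing booked.
[cite: GreenbergVatsal2000, §2 p. 26] [cite: GreenbergLNM1716, §2 p. 63] -/
theorem ClassX4Gord.eq_of_isRamifiedOrdinaryLine' (_hX : ClassX4Gord W p)
    {v : HeightOneSpectrum (𝓞 ℚ)} (hpv : ((p : ℕ) : 𝓞 ℚ) ∈ v.asIdeal)
    {L L' : LocalDatum ℚ ↥(W.geomPrimaryTorsion p) v} (hL : IsRamifiedOrdinaryLine W p L)
    (hL' : IsRamifiedOrdinaryLine W p L') : L = L' :=
  hL.eq_of_isRamifiedOrdinaryLine hL' hpv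

/-- **X3♯(G-ord), EVERY semistability defect, every `p` (`p = 2` included): the ramified ordinary
line is UNIQUE** — `ClassX3Gord.eq_of_isRamifiedOrdinaryLine` WITHOUT `hp2` and `he`. X3♯(G-ord)
stays as labelled; nothing booked. [cite: GreenbergVatsal2000, §2 p. 26] [cite: GreenbergLNM1716, §2 p. 63] -/
theorem ClassX3Gord.eq_of_isRamifiedOrdinaryLine' (_hX : ClassX3Gord W p)
    {v : HeightOneSpectrum (𝓞 ℚ)} (hpv : ((p : ℕ) : 𝓞 ℚ) ∈ v.asIdeal)
    {L L' : LocalDatum ℚ ↥(W.geomPrimaryTorsion p) v} (hL : IsRamifiedOrdinaryLine W p L)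
    (hL' : IsRamifiedOrdinaryLine W p L') : L = L' :=
  hL.eq_of_isRamifiedOrdinaryLine hL' hpv

/-- **X4♯(G-ord), every `e`: the δ-input from ONE identified line per `(κ, v)`** —
`ClassX4Gord.ramifiedLineKummerEqAt_of_exists` WITHOUT `he`. Nothing booked.
[cite: GreenbergVatsal2000, §2 p. 16 and p. 26] -/
theorem ClassX4Gord.ramifiedLineKummerEqAt_of_exists' (_hX : ClassX4Gord W p)
    (h : ∀ (κ : ZpExtension ℚ p), κ.IsCyclotomic →
      ∀ (v : HeightOneSpectrum (𝓞 ℚ)) (hv : ((p : ℕ) : 𝓞 ℚ) ∈ v.asIdeal),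
        ∃ L : LocalDatum ℚ (W.geomPrimaryTorsion p) v, IsRamifiedOrdinaryLine W p L ∧
          L.greenbergKer κ.kerSubgroup = W.localKerOver p κ.kerSubgroup (v.adicCompletion ℚ)) :
    RamifiedLineKummerEqAt W p :=
  Summit.BirchSwinnertonDyer.Rank1Residual.Additive.ramifiedLineKummerEqAt_of_exists W p h

/-- **X3♯(G-ord), every `e`, every `p`: the δ-input from ONE identified line per `(κ, v)`** —
`ClassX3Gord.ramifiedLineKummerEqAt_of_exists` WITHOUT `hp2`/`he`. Nothing booked.
[cite: GreenbergVatsal2000, §2 p. 16 and p. 26] -/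
theorem ClassX3Gord.ramifiedLineKummerEqAt_of_exists' (_hX : ClassX3Gord W p)
    (h : ∀ (κ : ZpExtension ℚ p), κ.IsCyclotomic →
      ∀ (v : HeightOneSpectrum (𝓞 ℚ)) (hv : ((p : ℕ) : 𝓞 ℚ) ∈ v.asIdeal),
        ∃ L : LocalDatum ℚ (W.geomPrimaryTorsion p) v, IsRamifiedOrdinaryLine W p L ∧
          L.greenbergKer κ.kerSubgroup = W.localKerOver p κ.kerSubgroup (v.adicCompletion ℚ)) :
    RamifiedLineKummerEqAt W p :=
  Summit.BirchSwinnertonDyer.Rank1Residual.Additive.ramifiedLineKummerEqAt_of_exists W p h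

end Summit.BirchSwinnertonDyer.Rank1Residual.Additive

end
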